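import Literature.NumberTheory.Sieve.JurkatRichertLinearSieveProofs
import Literature.NumberTheory.Sieve.PolynomialValuesSieveSequence
import Literature.NumberTheory.Sieve.BatemanHornMertensProduct

/-!
# The Jurkat–Richert upper bound for the prime values of one polynomial — generic layer

Solo unit `solo-Parity-informed` (ideation tier, informed mode), session 12; `PLAN.md` §20.5, CLAIMS C55.

This is the polynomial-generic part of the classical upper-bound sieve for `#{n ≤ N : |f(n)| prime}`
(Halberstam–Richert, *Sieve Methods*, Thm 5.3), extracted from the `n² + 1` file
`SoloInformedUpperBoundSieve` so that it can be fed any `f ∈ ℤ[X]`: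

* `exists_hasMertensHypothesisBelow_polyAPSeq` — the all-levels Mertens hypothesis (9.34) of the
  Jurkat–Richert theorem for the sequence `{f(n) : n ≤ N}` (`polyAPSeq f N 1 0`), with the primes `< u₁(ε)`
  exempted, from a sieve condition `∏_{w ≤ p < z} (1 - ρ_f(p)/p)⁻¹ ≤ (log z/log w)(1 + K/log w)`
  supplied as a hypothesis (`ρ_f = polyRootCountMod ![f]`);
* `card_primeValues_le_sieve` — for `f` with `ρ_f(p) < p` and `f(n) ≥ n` (`n ≥ 1`):
  `#{1 ≤ n ≤ N : |f(n)| prime} ≤ (2e^γ + ε e^{13}) ∏_{p<z} (1 - ρ_f(p)/p) · N + C z ∏_{p<u₁} p + z`,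
  the Jurkat–Richert bound (`LinearSieve.jurkatRichert_upper_allLevels_holds`, `F(1) = 2e^γ`, `D = z`)
  with remainders `|R_d| ≤ ρ_f(d)` (`abs_remainder_polyAPSeq_le`) summed by `∑_{m ≤ y} ρ_f(m) ≤ C y`;
* `tendsto_log_mul_prod_one_sub_rootCount_div_rpow` — for a Bateman–Horn polynomial `g`,
  `log N · ∏_{p < N^c} (1 - ρ_g(p)/p) → C(g) e^{-γ} / c` (`BatemanHornMertens`).

The quadratic case (where the sieve condition is the tree's `Iwaniec1978.rhoG_sieveConditionOne`) is
assembled in `SoloInformedQuadraticUpperBound`.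

References: W. B. Jurkat, H.-E. Richert, Acta Arith. 11 (1965) 217–240; H. Halberstam, H.-E. Richert,
*Sieve Methods* (Academic Press 1974) Thm 5.3; P. T. Bateman, R. A. Horn, Math. Comp. 16 (1962)
363–367 [BatemanHorn1962].
-/

namespace Summit.Parity.BatemanHorn.Theorems

open Finset Filter Asymptotics Polynomial
open scoped Topology
open Literature.NumberTheory.Sieve (polyRootCountMod IsBatemanHornSystem batemanHornConst primesProdBelow
  squarefree_primesProdBelow primeFactors_primesProdBelow dvd_primesProdBelow_iff polyAPSeq
  polyAPSeq_sifted polyAPSeq_size polyAPSeq_density polyAPSeq_densityProduct rootDensity_apply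
  abs_remainder_polyAPSeq_le apIndex mem_apIndex sum_filter_polyAPSeq_a_eq_card
  SieveSequence)
open Literature.NumberTheory.Sieve.BatemanHornMertens (tendsto_log_mul_prod_one_sub_rootCount_single
  tendsto_log_pow_mul_comp tendsto_ceil_rpow_sub_one_atTop tendsto_log_ceil_rpow_sub_one_div_log)

/-! ### The all-levels Mertens hypothesis from a sieve condition -/

/-- **Hypothesis (9.34) at all levels for `{f(n)}`.** If `∏_{w ≤ p < z} (1 - ρ_f(p)/p)⁻¹ ≤
(log z/log w)(1 + K/log w)` for `2 ≤ w < z`, then for every `ε > 0` there is `u₁ ≥ 2` such that,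
exempting the primes `< u₁`, the sequence `{f(n) : n ≤ N}` satisfies the Mertens hypothesis of the
Jurkat–Richert theorem with constant `ε` below every `z` (take `K/log u₁ ≤ ε/2`). -/
theorem exists_hasMertensHypothesisBelow_polyAPSeq (f : ℤ[X]) {K : ℝ} (hK1 : 1 ≤ K)
    (hK : ∀ w z : ℝ, 2 ≤ w → w < z →
      ∏ p ∈ (Nat.primesBelow ⌈z⌉₊).filter (fun p : ℕ => w ≤ (p : ℝ)),
          (1 - (polyRootCountMod ![f] p : ℝ) / p)⁻¹ ≤ Real.log z / Real.log w * (1 + K / Real.log w))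
    {ε : ℝ} (hε : 0 < ε) :
    ∃ u₁ : ℝ, 2 ≤ u₁ ∧ ∀ (N : ℕ) (z : ℝ),
      (polyAPSeq f N 1 0).HasMertensHypothesisBelow (primesProdBelow z)
        ((Nat.primesBelow ⌈z⌉₊).filter fun p : ℕ => (p : ℝ) < u₁) ε z := by
  refine ⟨max 2 (Real.exp (2 * K / ε)), le_max_left _ _, fun N z => ?_⟩
  set u₁ := max 2 (Real.exp (2 * K / ε)) with hu₁
  have hu₁2 : 2 ≤ u₁ := le_max_left _ _
  have hK0 : 0 < K := by linarith
  have hlogu₁ : 2 * K / ε ≤ Real.log u₁ := by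
    rw [← Real.log_exp (2 * K / ε)]
    exact Real.log_le_log (Real.exp_pos _) (le_max_right _ _)
  have h2Kε : 0 < 2 * K / ε := by positivity
  have hlogu₁0 : 0 < Real.log u₁ := h2Kε.trans_le hlogu₁
  refine SieveSequence.hasMertensHypothesisBelow_of_le hε fun u w hu huw hwz => ?_
  have hlogu : 0 < Real.log u := Real.log_pos hu
  have hloguw : Real.log u ≤ Real.log w := Real.log_le_log (by linarith) huw.le
  have hlogw : 0 < Real.log w := hlogu.trans_le hloguw
  -- the index set is `{p prime : p < w, max u u₁ ≤ p}`
  have hset : (((primesProdBelow z).primeFactors \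
      (Nat.primesBelow ⌈z⌉₊).filter fun p : ℕ => (p : ℝ) < u₁).filter
        fun p : ℕ => u ≤ (p : ℝ) ∧ (p : ℝ) < w)
      = (Nat.primesBelow ⌈w⌉₊).filter fun p : ℕ => max u u₁ ≤ (p : ℝ) := by
    ext p
    simp only [Finset.mem_filter, Finset.mem_sdiff, primeFactors_primesProdBelow,
      Nat.mem_primesBelow, Nat.lt_ceil, max_le_iff]
    constructor
    · rintro ⟨⟨⟨hpz, hp⟩, h2⟩, hup, hpw⟩
      refine ⟨⟨hpw, hp⟩, hup, ?_⟩
      by_contra h3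
      exact h2 ⟨⟨hpz, hp⟩, lt_of_not_ge h3⟩
    · rintro ⟨⟨hpw, hp⟩, hup, hu₁p⟩
      exact ⟨⟨⟨hpw.trans_le hwz, hp⟩, fun h => absurd h.2 (not_lt.mpr hu₁p)⟩, hup, hpw⟩
  rw [hset]
  simp only [polyAPSeq_density, rootDensity_apply]
  have hone : 1 ≤ Real.log w / Real.log u := (one_le_div hlogu).mpr hloguw
  by_cases hw' : max u u₁ < w
  · have hmax2 : 2 ≤ max u u₁ := le_max_of_le_right hu₁2
    have hlogmax : Real.log u ≤ Real.log (max u u₁) :=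
      Real.log_le_log (by linarith) (le_max_left _ _)
    have hlogmax₁ : Real.log u₁ ≤ Real.log (max u u₁) :=
      Real.log_le_log (by linarith) (le_max_right _ _)
    have hlogmax0 : 0 < Real.log (max u u₁) := hlogu.trans_le hlogmax
    refine (hK (max u u₁) w hmax2 hw').trans ?_
    have h1 : Real.log w / Real.log (max u u₁) ≤ Real.log w / Real.log u :=
      div_le_div_of_nonneg_left hlogw.le hlogu hlogmax
    have h2 : K / Real.log (max u u₁) ≤ ε / 2 :=
      calc K / Real.log (max u u₁) ≤ K / Real.log u₁ :=
            div_le_div_of_nonneg_left hK0.le hlogu₁0 hlogmax₁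
        _ ≤ K / (2 * K / ε) := div_le_div_of_nonneg_left hK0.le h2Kε hlogu₁
        _ = ε / 2 := by field_simp
    have h3 : 0 ≤ K / Real.log (max u u₁) := div_nonneg hK0.le hlogmax0.le
    calc Real.log w / Real.log (max u u₁) * (1 + K / Real.log (max u u₁))
        ≤ Real.log w / Real.log u * (1 + ε / 2) :=
          mul_le_mul h1 (by linarith) (by linarith) (div_nonneg hlogw.le hlogu.le)
      _ = (1 + ε / 2) * (Real.log w / Real.log u) := mul_comm _ _
  · rw [Finset.filter_false_of_mem, Finset.prod_empty]
    · exact one_le_mul_of_one_le_of_one_le (by linarith) hone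
    · intro p hp
      have hpw : (p : ℝ) < w := Nat.lt_ceil.mp (Nat.mem_primesBelow.mp hp).1
      exact not_le.mpr (hpw.trans_le (not_lt.mp hw'))

/-! ### The sieve bound at a fixed level `z` (`D = z`, `s = 1`) -/

/-- **The Jurkat–Richert bound for `{f(n) : n ≤ N}` at `s = 1`.** Let `f ∈ ℤ[X]` have `ρ_f(p) < p`
for every prime `p` and `f(n) ≥ n` for `n ≥ 1`. For `0 < ε < 1/200`, `z ≥ 2`, the primes `< u₁`
exempted as in `exists_hasMertensHypothesisBelow_polyAPSeq`, and `∑_{m ≤ y} ρ_f(m) ≤ C y` (`y ≥ 2`):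
`#{1 ≤ n ≤ N : |f(n)| prime} ≤ (2e^γ + ε e^{13}) ∏_{p<z} (1 - ρ_f(p)/p) · N + C z ∏_{p<u₁} p + z`
(sifted count `S(𝒜, P(z)) ≥ #{…} - z` because a prime value `< z` occurs at `n ≤ f(n) < z`;
remainders `|R_d| ≤ ρ_f(d)` summed over `d < z ∏_{p<u₁} p`). -/
theorem card_primeValues_le_sieve (f : ℤ[X]) (hlt : ∀ p : ℕ, p.Prime → polyRootCountMod ![f] p < p)
    (hval : ∀ n : ℕ, 1 ≤ n → (n : ℤ) ≤ f.eval (n : ℤ))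
    {ε u₁ z C : ℝ} (hε : 0 < ε) (hε' : ε < 1 / 200) (hz : 2 ≤ z) (N : ℕ)
    (hM : (polyAPSeq f N 1 0).HasMertensHypothesisBelow (primesProdBelow z)
      ((Nat.primesBelow ⌈z⌉₊).filter fun p : ℕ => (p : ℝ) < u₁) ε z)
    (hC : ∀ y : ℝ, 2 ≤ y → ∑ m ∈ Icc 1 ⌊y⌋₊, (polyRootCountMod ![f] m : ℝ) ≤ C * y) :
    (#((Icc 1 N).filter fun n : ℕ => Nat.Prime (f.eval (n : ℤ)).natAbs) : ℝ) ≤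
      (2 * Real.exp Real.eulerMascheroniConstant + ε * Real.exp 13) *
          ((∏ p ∈ Nat.primesBelow ⌈z⌉₊, (1 - (polyRootCountMod ![f] p : ℝ) / p)) * N)
        + C * (z * ((∏ p ∈ Nat.primesBelow ⌈u₁⌉₊, p : ℕ) : ℝ)) + z := by
  set Q := (Nat.primesBelow ⌈z⌉₊).filter fun p : ℕ => (p : ℝ) < u₁ with hQ
  set x : ℝ := (((Icc 1 N).sup fun n : ℕ => (f.eval (n : ℤ)).toNat : ℕ) : ℝ) with hx
  have hz0 : 0 ≤ z := by linarith
  have hlogz : 0 < Real.log z := Real.log_pos (by linarith)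
  have hIdx : apIndex N 1 0 = Icc 1 N := by
    ext n
    rw [mem_apIndex, mem_Icc]
    constructor
    · rintro ⟨⟨h1, h2⟩, -⟩; exact ⟨by omega, h2⟩
    · rintro ⟨h1, h2⟩; exact ⟨⟨by omega, h2⟩, Nat.modEq_one⟩
  have hpos : ∀ n : ℕ, 1 ≤ n → 0 < f.eval (n : ℤ) := fun n hn =>
    lt_of_lt_of_le (by exact_mod_cast hn) (hval n hn)
  -- the values on the index set are positive and `≤ x`
  have hxval : ∀ n ∈ apIndex N 1 0, 0 < f.eval (n : ℤ) ∧ ((f.eval (n : ℤ) : ℤ) : ℝ) ≤ x := by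
    intro n hn
    rw [hIdx] at hn
    have hn1 : 1 ≤ n := (mem_Icc.mp hn).1
    refine ⟨hpos n hn1, ?_⟩
    have h1 : f.eval (n : ℤ) ≤ (((f.eval (n : ℤ)).toNat : ℕ) : ℤ) := Int.self_le_toNat _
    have h2 : (f.eval (n : ℤ)).toNat ≤ (Icc 1 N).sup fun n : ℕ => (f.eval (n : ℤ)).toNat :=
      le_sup (f := fun n : ℕ => (f.eval (n : ℤ)).toNat) hn
    have h1' : ((f.eval (n : ℤ) : ℤ) : ℝ) ≤ (((f.eval (n : ℤ)).toNat : ℕ) : ℝ) := by exact_mod_cast h1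
    have h2' : (((f.eval (n : ℤ)).toNat : ℕ) : ℝ) ≤ x := by rw [hx]; exact_mod_cast h2
    exact h1'.trans h2'
  -- hypotheses of the Jurkat–Richert theorem
  have h01 : ∀ p ∈ (primesProdBelow z).primeFactors,
      0 ≤ (polyAPSeq f N 1 0).density p ∧ (polyAPSeq f N 1 0).density p < 1 := by
    intro p hp
    have hpr : p.Prime := Nat.prime_of_mem_primeFactors hp
    rw [polyAPSeq_density, rootDensity_apply]
    refine ⟨by positivity, ?_⟩
    rw [div_lt_one (by exact_mod_cast hpr.pos)]
    exact_mod_cast hlt p hpr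
  have hQsub : Q ⊆ (primesProdBelow z).primeFactors := by
    rw [primeFactors_primesProdBelow]; exact filter_subset _ _
  have hs : Real.log z / Real.log z = 1 := div_self hlogz.ne'
  have hX : (polyAPSeq f N 1 0).size x = N := by rw [polyAPSeq_size]; simp
  have hsize : (polyAPSeq f N 1 0).size x = ∑ n ∈ Ioc 0 ⌊x⌋₊, (polyAPSeq f N 1 0).a n := by
    have h := sum_filter_polyAPSeq_a_eq_card f N 1 0 hxval (fun _ => True)
    rw [Finset.filter_true, Finset.filter_true, hIdx, Nat.card_Icc, Nat.add_sub_cancel] at h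
    rw [h, hX]
  have hJR := Literature.NumberTheory.Sieve.LinearSieve.jurkatRichert_upper_allLevels_holds
    (polyAPSeq f N 1 0) x (primesProdBelow z) Q ε z z (squarefree_primesProdBelow z) dvd_rfl h01
    hQsub hε hε' hz le_rfl (by rw [hs]; norm_num) hsize hM
  rw [hs, div_one, show (14 : ℝ) - 1 = 13 by norm_num] at hJR
  -- the sifted count and the prime values
  have hsift : (polyAPSeq f N 1 0).sifted x (primesProdBelow z) =
      #((Icc 1 N).filter fun n : ℕ => (f.eval (n : ℤ)).natAbs.Coprime (primesProdBelow z)) := by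
    rw [polyAPSeq_sifted f N 1 0 hxval, hIdx]
  have hπ : (#((Icc 1 N).filter fun n : ℕ => Nat.Prime (f.eval (n : ℤ)).natAbs) : ℝ) ≤
      (polyAPSeq f N 1 0).sifted x (primesProdBelow z) + z := by
    have hsub : (Icc 1 N).filter (fun n : ℕ => Nat.Prime (f.eval (n : ℤ)).natAbs) ⊆
        (Icc 1 N).filter (fun n : ℕ => (f.eval (n : ℤ)).natAbs.Coprime (primesProdBelow z))
          ∪ Icc 1 ⌊z⌋₊ := by
      intro n hn
      rw [mem_filter] at hn
      rw [mem_union]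
      by_cases hc : (f.eval (n : ℤ)).natAbs.Coprime (primesProdBelow z)
      · exact Or.inl (mem_filter.mpr ⟨hn.1, hc⟩)
      · refine Or.inr (mem_Icc.mpr ?_)
        have hdvd : (f.eval (n : ℤ)).natAbs ∣ primesProdBelow z := by
          by_contra hnd
          exact hc ((Nat.Prime.coprime_iff_not_dvd hn.2).mpr hnd)
        have hltz : (((f.eval (n : ℤ)).natAbs : ℕ) : ℝ) < z := (dvd_primesProdBelow_iff hn.2 z).mp hdvd
        have hn1 : 1 ≤ n := (mem_Icc.mp hn.1).1
        refine ⟨hn1, Nat.le_floor ?_⟩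
        have h1 : (n : ℤ) ≤ ((f.eval (n : ℤ)).natAbs : ℤ) := (hval n hn1).trans Int.le_natAbs
        have h1' : (n : ℝ) ≤ (((f.eval (n : ℤ)).natAbs : ℕ) : ℝ) := by exact_mod_cast h1
        linarith
    calc (#((Icc 1 N).filter fun n : ℕ => Nat.Prime (f.eval (n : ℤ)).natAbs) : ℝ)
        ≤ #((Icc 1 N).filter (fun n : ℕ => (f.eval (n : ℤ)).natAbs.Coprime (primesProdBelow z))
            ∪ Icc 1 ⌊z⌋₊) := by
          exact_mod_cast card_le_card hsub
      _ ≤ #((Icc 1 N).filter fun n : ℕ => (f.eval (n : ℤ)).natAbs.Coprime (primesProdBelow z))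
            + #(Icc 1 ⌊z⌋₊) := by
          exact_mod_cast card_union_le _ _
      _ = (polyAPSeq f N 1 0).sifted x (primesProdBelow z) + ⌊z⌋₊ := by
          rw [hsift, Nat.card_Icc, Nat.add_sub_cancel]
      _ ≤ (polyAPSeq f N 1 0).sifted x (primesProdBelow z) + z := by
          gcongr; exact Nat.floor_le hz0
  -- main term
  have hV := polyAPSeq_densityProduct f N 1 0 z
  -- remainder
  set Pu : ℕ := ∏ p ∈ Nat.primesBelow ⌈u₁⌉₊, p with hPu
  have hPupos : 0 < Pu := prod_pos fun p hp => (Nat.mem_primesBelow.mp hp).2.pos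
  have hQprod : (∏ q ∈ Q, (q : ℝ)) ≤ (Pu : ℝ) := by
    have hdvd : (∏ q ∈ Q, q) ∣ Pu := prod_dvd_prod_of_subset _ _ _ fun p hp => by
      obtain ⟨hp1, hp2⟩ := mem_filter.mp hp
      exact Nat.mem_primesBelow.mpr ⟨Nat.lt_ceil.mpr hp2, (Nat.mem_primesBelow.mp hp1).2⟩
    have hle : ((∏ q ∈ Q, q : ℕ) : ℝ) ≤ (Pu : ℝ) := by exact_mod_cast Nat.le_of_dvd hPupos hdvd
    simpa only [Nat.cast_prod] using hle
  have hR : ∑ d ∈ (primesProdBelow z).divisors.filter (fun d : ℕ => (d : ℝ) < z * ∏ q ∈ Q, (q : ℝ)),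
      |(polyAPSeq f N 1 0).remainder d x| ≤ C * (z * Pu) := by
    have hsub : (primesProdBelow z).divisors.filter (fun d : ℕ => (d : ℝ) < z * ∏ q ∈ Q, (q : ℝ)) ⊆
        Icc 1 ⌊z * (Pu : ℝ)⌋₊ := by
      intro d hd
      obtain ⟨hdP, hdlt⟩ := mem_filter.mp hd
      rw [mem_Icc]
      refine ⟨Nat.pos_of_mem_divisors hdP, Nat.le_floor ?_⟩
      exact (hdlt.trans_le (mul_le_mul_of_nonneg_left hQprod hz0)).le
    calc ∑ d ∈ (primesProdBelow z).divisors.filter (fun d : ℕ => (d : ℝ) < z * ∏ q ∈ Q, (q : ℝ)),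
          |(polyAPSeq f N 1 0).remainder d x|
        ≤ ∑ d ∈ (primesProdBelow z).divisors.filter (fun d : ℕ => (d : ℝ) < z * ∏ q ∈ Q, (q : ℝ)),
            (polyRootCountMod ![f] d : ℝ) := by
          refine sum_le_sum fun d hd => ?_
          have hd0 : 0 < d := Nat.pos_of_mem_divisors (mem_filter.mp hd).1
          exact abs_remainder_polyAPSeq_le f (N := N) (q := 1) (r := 0) (m := d) one_pos hd0
            (Nat.coprime_one_left d) hxval
      _ ≤ ∑ d ∈ Icc 1 ⌊z * (Pu : ℝ)⌋₊, (polyRootCountMod ![f] d : ℝ) :=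
          sum_le_sum_of_subset_of_nonneg hsub fun _ _ _ => Nat.cast_nonneg _
      _ ≤ C * (z * Pu) := hC _ (by
          have : (1 : ℝ) ≤ Pu := by exact_mod_cast hPupos
          nlinarith)
  -- assemble
  rw [hV, hX] at hJR
  linarith [hπ, hJR, hR]

/-! ### The Mertens product at the sieving level `z = N^c` -/

/-- `log N · ∏_{p < N^c} (1 - ρ_g(p)/p) → C(g) e^{-γ} / c` (`c > 0`) for a polynomial `g` forming a
Bateman–Horn system: `BatemanHornMertens.tendsto_log_mul_prod_one_sub_rootCount_single` at the sieving
level `z = N^c`. -/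
theorem tendsto_log_mul_prod_one_sub_rootCount_div_rpow {g : ℤ[X]} (hg : IsBatemanHornSystem ![g])
    {c : ℝ} (hc : 0 < c) :
    Tendsto (fun N : ℕ => Real.log N *
        ∏ p ∈ Nat.primesBelow ⌈(N : ℝ) ^ c⌉₊, (1 - (polyRootCountMod ![g] p : ℝ) / p)) atTop
      (𝓝 (batemanHornConst ![g] * Real.exp (-Real.eulerMascheroniConstant) * c⁻¹)) := by
  have h : Tendsto (fun n : ℕ => Real.log n ^ 1 *
      ∏ p ∈ Nat.primesLE n, (1 - (polyRootCountMod ![g] p : ℝ) / p)) atTop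
      (𝓝 (batemanHornConst ![g] * Real.exp (-Real.eulerMascheroniConstant))) := by
    simpa only [pow_one] using tendsto_log_mul_prod_one_sub_rootCount_single hg
  have h2 := tendsto_log_pow_mul_comp 1 hc h (tendsto_ceil_rpow_sub_one_atTop hc)
    (tendsto_log_ceil_rpow_sub_one_div_log hc)
  simp only [pow_one] at h2
  refine h2.congr fun N => ?_
  rw [Nat.primesBelow_eq_primesLE_sub_one]

end Summit.Parity.BatemanHorn.Theorems
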